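import Literature.IUT.HodgeArakelov.ThetaEvaluationSetting
import Mathlib.GroupTheory.Torsion

/-!
# [IUTchII] Prop 2.2 (ii) — `θ^ι(Π_v)` as ι-invariants UP TO TORSION (repair file `IotaInvariantThetaR`, T1-N6)

Repair text for the LANDED `ThetaEvaluationSetting.lean` (p407103), L6-lead RULING 2026-08-25T20:18:12Z /
order 20:42:11Z (2) "`IotaInvariantTheta'` = T1-N6 (ι-invariants UP TO TORSION)". S. Mochizuki,
*Inter-universal Teichmüller theory II*, kurims manuscript Dec. 2020: Prop. 2.2 (ii) p. 66 ("together with the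
condition of invariance with respect to `ι` … determines a specific `μ_{2l}`-orbit `θ^ι(Π_v) ⊆ θ(Π_v)`"), read
with the CONVENTION of Cor. 1.12 (i) p. 57 ("we shall denote by means of a superscript `ι` the subset of
`ι`-invariants with respect to this 'action up to torsion', i.e., … those elements whose images in the
quotient … by its torsion subgroup are fixed by the induced action of `ι`"). The landed `IotaInvariantTheta`
asks for LITERAL fixed points `ι t = t`; since `Θ̈(−Ü) = −Θ̈(Ü)` ([EtTh] Prop. 1.4 (ii); tree:
`thetaDdot_neg`), the genuine classes are `ι`-fixed only up to the `2`-torsion Kummer class of `−1`, so the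
literal reading can be uninhabited at the model. Repair file of record per L6-lead RULING 2026-08-25T21:09:40Z
(the landed module stays frozen; the names `IotaInvariantTheta'`, `Prop22_ii'` are reserved to this file;
writer abc-iut-L6-t19; sibling repair files `ThetaEvaluationSettingR.lean` / `LabelClassesOfCuspsR.lean` by
abc-iut-L6-d1). Nothing here takes a side on [IUTchIII] Cor. 3.12.
-/

namespace Literature.IUT.HodgeArakelov

universe u

variable {S : BadPlaceSetting.{u}} {P : TopGroup.{u}} {T : TemperedCoverings S P}
  {D : EtaleThetaData S.toThetaSetting P}

/-- **IUTchII:Prop2.2(ii)′** (kurims p. 66), OUTPUT, repaired per Cor. 1.12 (i) p. 57: the action of `ι` on the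
cohomology (interface data — to be tied to `Dec.iota` once `CohomologySystem` carries functoriality in
automorphisms of `Π_v`; TODO-merge:abc-iut-L2-t1) and the printed orbit properties of the `ι`-invariants UP
TO TORSION: "`θ^ι(Π_v)`" is nonempty and any two of its elements differ by a `2l`-torsion class (a
`μ_{2l}`-orbit). [cite: Mochizuki2012, Prop 2.2 (ii) p.66] -/
structure IotaInvariantTheta' (Dec : SubgraphDecomposition S T D) : Type (u + 1) where
  /-- the action of `ι` on `H¹(Π_Ÿ(Π_v), (l·Δ_Θ)(Π_v))` and on the direct limit -/
  iotaH1 : D.coh.H1 ⊤ ≃+ D.coh.H1 ⊤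
  iotaLim : D.coh.lim ≃+ D.coh.lim
  iota_compat : ∀ x, D.coh.toLim ⊤ (iotaH1 x) = iotaLim (D.coh.toLim ⊤ x)
  /-- `ι` preserves `θ(Π_v)` -/
  iota_theta : iotaH1 '' D.theta = D.theta
  /-- `θ^ι(Π_v) ≠ ∅`: some class of `θ(Π_v)` is `ι`-invariant up to torsion -/
  thetaIota_nonempty : ∃ t ∈ D.theta, IsOfFinAddOrder (iotaH1 t - t)
  /-- `θ^ι(Π_v)` is a `μ_{2l}`-orbit: any two `ι`-invariants up to torsion differ by a `2l`-torsion class -/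
  thetaIota_orbit : ∀ t ∈ D.theta, ∀ t' ∈ D.theta, IsOfFinAddOrder (iotaH1 t - t) →
    IsOfFinAddOrder (iotaH1 t' - t') → (2 * S.l) • (t' - t) = 0

namespace IotaInvariantTheta'

variable {Dec : SubgraphDecomposition S T D} (Θ : IotaInvariantTheta' Dec)

/-- **IUTchII:Prop2.2(ii)′**: `θ^ι(Π_v) ⊆ θ(Π_v)`, the classes `ι`-invariant UP TO TORSION (DEFINED; Cor. 1.12 (i)
convention). [cite: Mochizuki2012, Prop 2.2 (ii) p.66] -/
def thetaIota : Set (D.coh.H1 ⊤) := {t ∈ D.theta | IsOfFinAddOrder (Θ.iotaH1 t - t)}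

/-- **IUTchII:Prop2.2(ii)′**: `∞θ^ι(Π_v) ⊆ ∞θ(Π_v)`, the elements `ι`-invariant UP TO TORSION (DEFINED).
[cite: Mochizuki2012, Prop 2.2 (ii) p.66] -/
def thetaInftyIota : Set D.coh.lim := {x ∈ D.thetaInfty | IsOfFinAddOrder (Θ.iotaLim x - x)}

/-- `θ^ι(Π_v)` is nonempty (from `thetaIota_nonempty`). [cite: Mochizuki2012, Prop 2.2 (ii) p.66] -/
theorem thetaIota_nonempty' : Θ.thetaIota.Nonempty := by
  obtain ⟨t, ht, h⟩ := Θ.thetaIota_nonempty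
  exact ⟨t, ht, h⟩

/-- A LITERAL fixed point is invariant up to torsion: the landed (v1) notion refines the printed one, so every
v1 `ι`-invariant class lies in `θ^ι` — the converse is what fails at the model. [cite: Mochizuki2012, Cor 1.12 (i) p.57] -/
theorem mem_thetaIota_of_fixed {t : D.coh.H1 ⊤} (ht : t ∈ D.theta) (hfix : Θ.iotaH1 t = t) :
    t ∈ Θ.thetaIota := by
  refine ⟨ht, ?_⟩
  rw [hfix, sub_self]
  exact IsOfFinAddOrder.zero

end IotaInvariantTheta'

/-- **IUTchII:Prop2.2(ii)′** existence (kurims pp. 66–67: "follows immediately from the results of [EtTh]"),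
PREDICATE on the Prop. 2.2 (i) output `Dec`, over the repaired structure. [cite: Mochizuki2012, Prop 2.2 (ii) p.66] -/
def Prop22_ii' (Dec : SubgraphDecomposition S T D) : Prop :=
  Nonempty (IotaInvariantTheta' Dec)

end Literature.IUT.HodgeArakelov
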